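import Literature.AlgebraicGeometry.Motives.MixedHodgeStructureHomRadicalMultiplicity
import Literature.AlgebraicGeometry.Motives.MixedHodgeStructureEndAlgPi
import HarnessLib

/-!
# `dim Hom_MHS(H,H') − dim Rad(H,H')` is symmetric in `H`, `H'`: the tops of the `Hom`-spaces of mixed Hodge structures

Topic `Literature/AlgebraicGeometry/Motives`, namespace `Literature.AlgebraicGeometry.Motives.MixedHodgeStructure`; sequel of
`MixedHodgeStructureHomRadicalMultiplicity` (g40-#15: `dim Rad(⊕ Sᵢ, C) = Σ dim Rad(Sᵢ, C)`, the atoms for indecomposable `S`, `C`, the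
multiplicity formula) and of the tree's `MixedHodgeStructureEndAlgPi` (`finrank_endAlg_eq_of_iso`).  Here the TARGET-side additivity
`dim Rad(C, ⊕ Tⱼ) = Σ dim Rad(C, Tⱼ)` is added, and the two are combined over Krull–Schmidt decompositions of both objects.  Everything proved;
no definition, no named fact, no instance (net debt 0).

## The sources, verbatim

H. Krause, *Krull–Schmidt categories and projective covers* [Krause2015KS], §4: «Let `𝒜` be a Krull–Schmidt category and let `X = X₁ ⊕ … ⊕ X_r`
and `Y = Y₁ ⊕ … ⊕ Y_s` be decompositions of two objects `X, Y` into indecomposable objects. Then we have `Rad_𝒜(X,Y) = ⊕_{i,j} Rad_𝒜(Xᵢ,Yⱼ)`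
and `Rad_𝒜(Xᵢ,Yⱼ)` equals the set of non-invertible morphisms `Xᵢ → Yⱼ` for each pair `i,j`»; Thm. 4.2 (uniqueness of the decomposition).
I. Assem, D. Simson, A. Skowroński [AssemSkowronskiSimson2006], A.3 Prop. 3.5 «(a) `rad_𝒞(Z,Z)` is the Jacobson radical of `End_𝒞 Z` (b) …
if `X ≇ Y` then `rad_𝒞(X,Y) = Hom_𝒞(X,Y)`»; IV.1 p. 99 «`rad_A(X,Y)` is an `End Y`–`End X`-subbimodule of `Hom_A(X,Y)`».  Consequence
formalised here (summing Krause's formula over both decompositions; each pair `Sᵢ ≅ Tⱼ` contributes `dim_ℚ(End ∕ rad End)` of the common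
isomorphism class to `dim Hom ∕ Rad` in either direction): **`dim_ℚ Hom_MHS(H,H') − dim_ℚ Rad(H,H') = dim_ℚ Hom_MHS(H',H) − dim_ℚ Rad(H',H)`.**

## What is formalised

* §1 target-side components along `H' = ⊕ Tⱼ` (`πⱼ ∘ Σₖ ιₖ gₖ = gⱼ`, `Σⱼ ιⱼ πⱼ f = f`), the counting lemma, and
  **`dim Rad(C, ⊕ Tⱼ) = Σⱼ dim Rad(C, Tⱼ)`**, **`dim Hom_MHS(C, ⊕ Tⱼ) = Σⱼ dim Hom_MHS(C, Tⱼ)`** (`finrank_radHom_eq_sum_right`,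
  `finrank_hodgeClasses_hom_eq_sum_right`).
* §2 isomorphism invariance of `dim Rad(C, −)` (`finrank_radHom_eq_of_iso_right`); `dim rad End S = dim rad End T` for `S ≅ T`.
* §3 **the symmetric atom**: for indecomposable `S`, `T`: `dim Hom(S,T) + dim Rad(T,S) = dim Hom(T,S) + dim Rad(S,T)`.
* §4 **`dim Hom_MHS(H,H') + dim Rad(H',H) = dim Hom_MHS(H',H) + dim Rad(H,H')` for ALL mixed Hodge structures `H`, `H'`**
  (`finrank_hom_add_finrank_radHom_comm`, through Krull–Schmidt decompositions of both), and **`Rad(H,H') = Hom_MHS(H,H')` iff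
  `Rad(H',H) = Hom_MHS(H',H)`** (`radHom_eq_hodgeClasses_hom_comm`: «no common indecomposable summand» is a symmetric relation).

## Mathlib ∕ Literature search

Tree REUSED: g40-#15 (`sum_comp_subtype_comp_proj`-style identities, `finrank_radHom_eq_sum`, `finrank_hodgeClasses_hom_eq_sum`,
`finrank_radHom_eq_of_iso_left`, `finrank_hodgeClasses_hom_eq_finrank_endAlg_of_iso`, `finrank_radHom_eq_finrank_jacobson_of_iso`,
`IsIndecomposable.finrank_hodgeClasses_hom_eq_finrank_radHom`), g40-#3 `radHom`, `finrank_radHom_le`, `radHom_le_hodgeClasses_hom`,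
`finrank_radHom_self_eq`; tree `exists_iSupIndep_isIndecomposable`, `SubMixedHodgeStructure.proj…`, `finrank_endAlg_eq_of_iso`, `Hom.inverse`;
Mathlib `Module.finrank_pi_fintype`, `Submodule.eq_of_le_of_finrank_eq`.  presearch: «dimension of Hom modulo radical symmetric» (lit search
--hybrid, galaxy «radical of a category|Rad(X,Y)») → Krause 2015 §4, ASS A.3 (the ingredients; the symmetric count is their immediate
consequence, not found printed as such — stated here as a corollary with both cited); `rg "finrank_hom_add_finrank_radHom_comm" lean/Literature` → none.

## References

* H. Krause, *Krull–Schmidt categories and projective covers*, Expo. Math. 33 (2015): §4 (remark after Cor. 4.4), Thm. 4.2. [Krause2015KS]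
* I. Assem, D. Simson, A. Skowroński, *Elements of the Representation Theory of Associative Algebras 1* (2006): IV.1 (p. 99), A.3 Prop. 3.5. [AssemSkowronskiSimson2006]
* H. Krause, *Homological Theory of Representations* (2021): §13.1 (SF1). [Krause2021]
* E. Cattani, F. El Zein, P. Griffiths, Lê D. T. (eds.), *Hodge Theory* (2014): Thm. 3.2.18, p. 270. [CattaniElZeinGriffithsLe2014]

## Provenance

Lane `lit-hodgefound` (summit `HodgeConjecture`, Track 2 foundations library), seat `lit-hodgefound-p36` (literature-prover, generation 40,
row g40-#16). HC is not proved; nothing here bears on the Hodge conjecture beyond foundations.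
-/

noncomputable section

namespace Literature.AlgebraicGeometry.Motives

namespace MixedHodgeStructure

open Module

universe u v w u₁ u₂

variable {V : Type u} [AddCommGroup V] [Module ℚ V] {H : MixedHodgeStructure V}
variable {VC : Type w} [AddCommGroup VC] [Module ℚ VC] {C : MixedHodgeStructure VC}

/-! ### §1 Target-side components along `H = ⊕ Tⱼ` (maps `C → H`) -/

section Components

variable {κ : Type v} [Fintype κ]
variable (T : κ → SubMixedHodgeStructure H) (hT : iSupIndep fun j => (T j).toSubmodule) (hT' : (⨆ j, (T j).toSubmodule) = ⊤)

include hT hT'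

/-- **`πⱼ ∘ (Σₖ ιₖ ∘ gₖ) = gⱼ`.** [cite: Krause2015KS, §4] [cite: AssemSkowronskiSimson2006, A.3 Lemma 3.4 (b) (proof)] -/
theorem proj_comp_sum_subtype_comp (g : ∀ j, VC →ₗ[ℚ] ↥(T j).toSubmodule) (j : κ) :
    (SubMixedHodgeStructure.proj T hT hT' j).toLinearMap ∘ₗ (∑ k, (T k).toSubmodule.subtype ∘ₗ g k) = g j := by
  classical
  refine LinearMap.ext fun x => ?_
  rw [LinearMap.comp_apply, LinearMap.sum_apply, map_sum, Finset.sum_eq_single j]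
  · rw [LinearMap.comp_apply, Submodule.subtype_apply, SubMixedHodgeStructure.proj_apply_coe]
  · intro k _ hkj
    rw [LinearMap.comp_apply, Submodule.subtype_apply, SubMixedHodgeStructure.proj_apply_of_mem_ne T hT hT' hkj (g k x).2]
  · intro h
    exact absurd (Finset.mem_univ j) h

/-- **`Σⱼ ιⱼ ∘ πⱼ ∘ f = f`.** [cite: Krause2015KS, §4] [cite: AssemSkowronskiSimson2006, A.3 Lemma 3.4 (b) (proof)] -/
theorem sum_subtype_comp_proj_comp (f : VC →ₗ[ℚ] V) :
    ∑ j, (T j).toSubmodule.subtype ∘ₗ ((SubMixedHodgeStructure.proj T hT hT' j).toLinearMap ∘ₗ f) = f := by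
  refine LinearMap.ext fun x => ?_
  rw [LinearMap.sum_apply]
  simp only [LinearMap.comp_apply, Submodule.subtype_apply]
  exact SubMixedHodgeStructure.sum_coe_proj_apply T hT hT' (f x)

/-- **Counting lemma, target side**: a subspace `P ⊆ Hom_ℚ(V_C, V)` with components `πⱼ ∘ f` in `Qⱼ ⊆ Hom_ℚ(V_C, Tⱼ)` and containing
`Σⱼ ιⱼ ∘ gⱼ` for `gⱼ ∈ Qⱼ` has `dim P = Σⱼ dim Qⱼ`. [cite: Krause2015KS, §4] [cite: Krause2021, §13.1 (SF1)] -/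
theorem finrank_eq_sum_of_components_right [FiniteDimensional ℚ V] [FiniteDimensional ℚ VC] (P : Submodule ℚ (VC →ₗ[ℚ] V))
    (Q : ∀ j, Submodule ℚ (VC →ₗ[ℚ] ↥(T j).toSubmodule))
    (h1 : ∀ f ∈ P, ∀ j, (SubMixedHodgeStructure.proj T hT hT' j).toLinearMap ∘ₗ f ∈ Q j)
    (h2 : ∀ g : ∀ j, VC →ₗ[ℚ] ↥(T j).toSubmodule, (∀ j, g j ∈ Q j) → (∑ j, (T j).toSubmodule.subtype ∘ₗ g j) ∈ P) :
    finrank ℚ P = ∑ j, finrank ℚ (Q j) := by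
  let Ψ : P →ₗ[ℚ] (∀ j, Q j) :=
    { toFun := fun f j => ⟨(SubMixedHodgeStructure.proj T hT hT' j).toLinearMap ∘ₗ f.1, h1 f.1 f.2 j⟩
      map_add' := fun f g => funext fun j => Subtype.ext (LinearMap.comp_add _ _ _)
      map_smul' := fun c f => funext fun j => Subtype.ext (LinearMap.comp_smul _ _ _) }
  have hΨ : Function.Bijective Ψ := by
    constructor
    · intro f g hfg
      apply Subtype.ext
      rw [← sum_subtype_comp_proj_comp T hT hT' f.1, ← sum_subtype_comp_proj_comp T hT hT' g.1]
      refine Finset.sum_congr rfl fun j _ => ?_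
      have h := congrArg (fun k : ∀ j, Q j => ((k j : Q j) : VC →ₗ[ℚ] ↥(T j).toSubmodule)) hfg
      exact congrArg (fun k : VC →ₗ[ℚ] ↥(T j).toSubmodule => (T j).toSubmodule.subtype ∘ₗ k) h
    · intro g
      refine ⟨⟨∑ j, (T j).toSubmodule.subtype ∘ₗ (g j : VC →ₗ[ℚ] ↥(T j).toSubmodule), h2 _ fun j => (g j).2⟩,
        funext fun j => Subtype.ext ?_⟩
      exact proj_comp_sum_subtype_comp T hT hT' _ j
  haveI : ∀ j, Module.Free ℚ (Q j) := fun j => Module.Free.of_divisionRing ℚ (Q j)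
  rw [(LinearEquiv.ofBijective Ψ hΨ).finrank_eq, Module.finrank_pi_fintype]

/-- **`dim_ℚ Rad(C, ⊕ Tⱼ) = Σⱼ dim_ℚ Rad(C, Tⱼ)`** (Krause's `Rad(X, ⊕Yⱼ) = ⊕ Rad(X, Yⱼ)` as a dimension count). [cite: Krause2015KS, §4]
[cite: AssemSkowronskiSimson2006, A.3 Lemma 3.4 (b)] -/
theorem finrank_radHom_eq_sum_right [FiniteDimensional ℚ V] [FiniteDimensional ℚ VC] :
    finrank ℚ (radHom C H) = ∑ j, finrank ℚ (radHom C (T j).toMixedHodgeStructure) := by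
  refine finrank_eq_sum_of_components_right T hT hT' (radHom C H) (fun j => radHom C (T j).toMixedHodgeStructure) ?_ ?_
  · intro f hf j
    have hφ := (Hom.toLinearMap_mem_radHom_iff (Hom.ofIsHom (isHom_of_mem_radHom hf))).1 hf
    exact (hφ.comp_left (SubMixedHodgeStructure.proj T hT hT' j)).toLinearMap_mem_radHom
  · intro g hg
    refine Submodule.sum_mem _ fun j _ => ?_
    have hφ := (Hom.toLinearMap_mem_radHom_iff (Hom.ofIsHom (isHom_of_mem_radHom (hg j)))).1 (hg j)
    exact (hφ.comp_left (T j).subtype).toLinearMap_mem_radHom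

/-- **`dim_ℚ Hom_MHS(C, ⊕ Tⱼ) = Σⱼ dim_ℚ Hom_MHS(C, Tⱼ)`** ((SF1) for `Hom(C, −)` along a finite internal decomposition).
[cite: Krause2021, §13.1 (SF1)] [cite: CattaniElZeinGriffithsLe2014, Thm. 3.2.18] -/
theorem finrank_hodgeClasses_hom_eq_sum_right [FiniteDimensional ℚ V] [FiniteDimensional ℚ VC] :
    finrank ℚ ((hom C H).hodgeClasses 0) = ∑ j, finrank ℚ ((hom C (T j).toMixedHodgeStructure).hodgeClasses 0) := by
  refine finrank_eq_sum_of_components_right T hT hT' _ (fun j => (hom C (T j).toMixedHodgeStructure).hodgeClasses 0) ?_ ?_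
  · intro f hf j
    have hf' := (mem_hodgeClasses_hom_zero_iff C H f).1 hf
    exact (mem_hodgeClasses_hom_zero_iff C _ _).2 ((SubMixedHodgeStructure.proj T hT hT' j).comp (Hom.ofIsHom hf')).isHom
  · intro g hg
    refine Submodule.sum_mem _ fun j _ => ?_
    exact (mem_hodgeClasses_hom_zero_iff C H _).2
      (((T j).subtype.comp (Hom.ofIsHom ((mem_hodgeClasses_hom_zero_iff C _ _).1 (hg j)))).isHom)

end Components

/-! ### §2 Isomorphism invariance of `dim Rad(C, −)` -/

section Iso

variable {V₁ : Type u₁} [AddCommGroup V₁] [Module ℚ V₁] {H₁ : MixedHodgeStructure V₁}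
variable {V₂ : Type u₂} [AddCommGroup V₂] [Module ℚ V₂] {H₂ : MixedHodgeStructure V₂}

/-- **`dim Rad(C, H₁) = dim Rad(C, H₂)` for `H₁ ≅ H₂`** (`φ ↦ e ∘ φ`). [cite: Krause2015KS, §2 Prop. 2.9] [cite: AssemSkowronskiSimson2006, IV.1 (p. 99)] -/
theorem finrank_radHom_eq_of_iso_right [FiniteDimensional ℚ V₂] [FiniteDimensional ℚ VC] (e : Hom H₁ H₂) (he : Function.Bijective e.toLinearMap) :
    finrank ℚ (radHom C H₁) = finrank ℚ (radHom C H₂) := by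
  let L : (VC →ₗ[ℚ] V₁) →ₗ[ℚ] (VC →ₗ[ℚ] V₂) :=
    { toFun := fun g => e.toLinearMap ∘ₗ g
      map_add' := fun g g' => LinearMap.comp_add _ _ _
      map_smul' := fun c g => LinearMap.comp_smul _ _ _ }
  have hL : Function.Injective L := fun g g' h => (LinearMap.cancel_left he.1).1 h
  have hmap : (radHom C H₁).map L = radHom C H₂ := by
    refine le_antisymm ?_ fun f hf => ?_
    · rintro _ ⟨g, hg, rfl⟩
      have hψ := (Hom.toLinearMap_mem_radHom_iff (Hom.ofIsHom (isHom_of_mem_radHom hg))).1 hg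
      exact (hψ.comp_left e).toLinearMap_mem_radHom
    · have hφ := (Hom.toLinearMap_mem_radHom_iff (Hom.ofIsHom (isHom_of_mem_radHom hf))).1 hf
      refine ⟨((e.inverse he).comp (Hom.ofIsHom (isHom_of_mem_radHom hf))).toLinearMap, (hφ.comp_left (e.inverse he)).toLinearMap_mem_radHom, ?_⟩
      refine LinearMap.ext fun x => ?_
      change (e.comp ((e.inverse he).comp (Hom.ofIsHom (isHom_of_mem_radHom hf)))).toLinearMap x = f x
      rw [← Hom.comp_assoc', Hom.comp_inverse]
      rfl
  rw [← hmap]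
  exact (Submodule.equivMapOfInjective L hL (radHom C H₁)).finrank_eq

/-- `dim Hom_MHS(C, H₁) = dim Hom_MHS(C, H₂)` for `H₁ ≅ H₂`. [cite: CattaniElZeinGriffithsLe2014, Thm. 3.2.18] [cite: DeligneHodgeII1971, 1.1.12] -/
theorem finrank_hodgeClasses_hom_eq_of_iso_right [FiniteDimensional ℚ V₁] [FiniteDimensional ℚ V₂] [FiniteDimensional ℚ VC] (e : Hom H₁ H₂)
    (he : Function.Bijective e.toLinearMap) : finrank ℚ ((hom C H₁).hodgeClasses 0) = finrank ℚ ((hom C H₂).hodgeClasses 0) :=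
  finrank_hodgeClasses_eq_of_bijective (Hom.homMap (Hom.id C) e) (Hom.homMap_bijective _ _ Function.bijective_id he) 0

/-- `dim Hom_MHS(H₁, C) = dim Hom_MHS(H₂, C)` for `H₁ ≅ H₂`. [cite: CattaniElZeinGriffithsLe2014, Thm. 3.2.18] [cite: DeligneHodgeII1971, 1.1.12] -/
theorem finrank_hodgeClasses_hom_eq_of_iso_left [FiniteDimensional ℚ V₁] [FiniteDimensional ℚ V₂] [FiniteDimensional ℚ VC] (e : Hom H₁ H₂)
    (he : Function.Bijective e.toLinearMap) : finrank ℚ ((hom H₁ C).hodgeClasses 0) = finrank ℚ ((hom H₂ C).hodgeClasses 0) :=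
  (finrank_hodgeClasses_eq_of_bijective (Hom.homMap e (Hom.id C)) (Hom.homMap_bijective _ _ he Function.bijective_id) 0).symm

/-- **`dim rad End_MHS(H₁) = dim rad End_MHS(H₂)` for `H₁ ≅ H₂`** (`Rad(H₁,H₁) ≅ Rad(H₂,H₁) ≅ Rad(H₂,H₂)`). [cite: AssemSkowronskiSimson2006, A.3 Prop. 3.5 (a)]
[cite: Krause2015KS, §2 Prop. 2.9] -/
theorem finrank_jacobson_endAlg_eq_of_iso [FiniteDimensional ℚ V₁] [FiniteDimensional ℚ V₂] (e : Hom H₁ H₂) (he : Function.Bijective e.toLinearMap) :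
    finrank ℚ ((Ring.jacobson H₁.endAlg).restrictScalars ℚ) = finrank ℚ ((Ring.jacobson H₂.endAlg).restrictScalars ℚ) := by
  rw [← finrank_radHom_self_eq, ← finrank_radHom_self_eq, finrank_radHom_eq_of_iso_left e he, finrank_radHom_eq_of_iso_right e he]

end Iso

/-! ### §3 The symmetric atom for indecomposable `S`, `T` -/

section Atom

variable [FiniteDimensional ℚ V] [FiniteDimensional ℚ VC]

/-- **For indecomposable `S`, `T`: `dim Hom(S,T) + dim Rad(T,S) = dim Hom(T,S) + dim Rad(S,T)`** (both sides are `dim Rad(S,T) + dim Rad(T,S)`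
if `S ≇ T`, and `dim End + dim rad End` of the common isomorphism class if `S ≅ T`). [cite: Krause2015KS, §4] [cite: AssemSkowronskiSimson2006, A.3 Prop. 3.5] -/
theorem IsIndecomposable.finrank_hom_add_finrank_radHom_comm (hH : H.IsIndecomposable) (hC : C.IsIndecomposable) :
    finrank ℚ ((hom H C).hodgeClasses 0) + finrank ℚ (radHom C H) = finrank ℚ ((hom C H).hodgeClasses 0) + finrank ℚ (radHom H C) := by
  by_cases h : ∃ e : Hom H C, Function.Bijective e.toLinearMap
  · obtain ⟨e, he⟩ := h
    have hinv : Function.Bijective (e.inverse he).toLinearMap := by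
      rw [Hom.inverse_toLinearMap]
      exact (LinearEquiv.ofBijective e.toLinearMap he).symm.bijective
    rw [finrank_hodgeClasses_hom_eq_finrank_endAlg_of_iso e he, finrank_hodgeClasses_hom_eq_finrank_endAlg_of_iso (e.inverse he) hinv,
      finrank_radHom_eq_finrank_jacobson_of_iso e he, finrank_radHom_eq_finrank_jacobson_of_iso (e.inverse he) hinv,
      finrank_endAlg_eq_of_iso e he, finrank_jacobson_endAlg_eq_of_iso e he]
  · have h' : ∀ e : Hom C H, ¬Function.Bijective e.toLinearMap := fun e he =>
      h ⟨e.inverse he, by rw [Hom.inverse_toLinearMap]; exact (LinearEquiv.ofBijective e.toLinearMap he).symm.bijective⟩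
    push Not at h
    rw [hH.finrank_hodgeClasses_hom_eq_finrank_radHom hC h, hC.finrank_hodgeClasses_hom_eq_finrank_radHom hH h', add_comm]

end Atom

/-! ### §4 The symmetry `dim Hom(H,H') − dim Rad(H,H') = dim Hom(H',H) − dim Rad(H',H)` -/

section Symmetry

variable {V' : Type u₁} [AddCommGroup V'] [Module ℚ V'] {H' : MixedHodgeStructure V'}
variable [FiniteDimensional ℚ V] [FiniteDimensional ℚ V']

/-- **For all mixed Hodge structures `H`, `H'`: `dim_ℚ Hom_MHS(H,H') + dim_ℚ Rad(H',H) = dim_ℚ Hom_MHS(H',H) + dim_ℚ Rad(H,H')`** —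
`dim Hom ∕ Rad` is symmetric (sum Krause's `Rad(⊕Sᵢ, ⊕Tⱼ) = ⊕ Rad(Sᵢ,Tⱼ)` and `Hom(⊕Sᵢ, ⊕Tⱼ) = ⊕ Hom(Sᵢ,Tⱼ)` over Krull–Schmidt
decompositions of `H` and `H'` and use the symmetric atom §3). [cite: Krause2015KS, §4 (remark after Cor. 4.4)] [cite: AssemSkowronskiSimson2006, A.3 Prop. 3.5]
[cite: CattaniElZeinGriffithsLe2014, Thm. 3.2.18 and p. 270] -/
theorem finrank_hom_add_finrank_radHom_comm (H : MixedHodgeStructure V) (H' : MixedHodgeStructure V') :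
    finrank ℚ ((hom H H').hodgeClasses 0) + finrank ℚ (radHom H' H) = finrank ℚ ((hom H' H).hodgeClasses 0) + finrank ℚ (radHom H H') := by
  obtain ⟨n, S, hS, hS', hSi⟩ := exists_iSupIndep_isIndecomposable H
  obtain ⟨m, T, hT, hT', hTj⟩ := exists_iSupIndep_isIndecomposable H'
  rw [finrank_hodgeClasses_hom_eq_sum S hS hS', finrank_radHom_eq_sum S hS hS', finrank_hodgeClasses_hom_eq_sum_right S hS hS',
    finrank_radHom_eq_sum_right S hS hS', ← Finset.sum_add_distrib, ← Finset.sum_add_distrib]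
  refine Finset.sum_congr rfl fun i _ => ?_
  rw [finrank_hodgeClasses_hom_eq_sum_right T hT hT', finrank_radHom_eq_sum_right T hT hT', finrank_hodgeClasses_hom_eq_sum T hT hT',
    finrank_radHom_eq_sum T hT hT', ← Finset.sum_add_distrib, ← Finset.sum_add_distrib]
  exact Finset.sum_congr rfl fun j _ => (hSi i).finrank_hom_add_finrank_radHom_comm (hTj j)

/-- As a difference of natural numbers: **`dim Hom_MHS(H,H') − dim Rad(H,H') = dim Hom_MHS(H',H) − dim Rad(H',H)`.**
[cite: Krause2015KS, §4 (remark after Cor. 4.4)] [cite: AssemSkowronskiSimson2006, A.3 Prop. 3.5] -/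
theorem finrank_hom_sub_finrank_radHom_comm (H : MixedHodgeStructure V) (H' : MixedHodgeStructure V') :
    finrank ℚ ((hom H H').hodgeClasses 0) - finrank ℚ (radHom H H') = finrank ℚ ((hom H' H).hodgeClasses 0) - finrank ℚ (radHom H' H) := by
  have h := finrank_hom_add_finrank_radHom_comm H H'
  have h1 := finrank_radHom_le (H := H) (H' := H')
  have h2 := finrank_radHom_le (H := H') (H' := H)
  omega

/-- **`Rad(H,H') = Hom_MHS(H,H')` iff `Rad(H',H) = Hom_MHS(H',H)`** — «`H` and `H'` have no common indecomposable summand» read from either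
side. [cite: Krause2015KS, §4 (remark after Cor. 4.4)] [cite: AssemSkowronskiSimson2006, A.3 Prop. 3.5 (b)] -/
theorem radHom_eq_hodgeClasses_hom_comm (H : MixedHodgeStructure V) (H' : MixedHodgeStructure V') :
    radHom H H' = (hom H H').hodgeClasses 0 ↔ radHom H' H = (hom H' H).hodgeClasses 0 := by
  have h := finrank_hom_add_finrank_radHom_comm H H'
  constructor
  · intro h1
    rw [h1] at h
    exact Submodule.eq_of_le_of_finrank_eq radHom_le_hodgeClasses_hom (by omega)
  · intro h1
    rw [h1] at h
    exact Submodule.eq_of_le_of_finrank_eq radHom_le_hodgeClasses_hom (by omega)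

/-- Equivalently: **every morphism `H → H'` is radical iff every morphism `H' → H` is radical.** [cite: Krause2015KS, §4 (remark after Cor. 4.4)]
[cite: AssemSkowronskiSimson2006, A.3 Prop. 3.5 (b)] -/
theorem forall_isRadical_comm (H : MixedHodgeStructure V) (H' : MixedHodgeStructure V') :
    (∀ φ : Hom H H', φ.IsRadical) ↔ ∀ ψ : Hom H' H, ψ.IsRadical := by
  have key : ∀ {U : Type u} {U' : Type u₁} [AddCommGroup U] [Module ℚ U] [AddCommGroup U'] [Module ℚ U'] [FiniteDimensional ℚ U]
      [FiniteDimensional ℚ U'] (G : MixedHodgeStructure U) (G' : MixedHodgeStructure U'),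
      (∀ φ : Hom G G', φ.IsRadical) ↔ radHom G G' = (hom G G').hodgeClasses 0 := by
    intro U U' _ _ _ _ _ _ G G'
    constructor
    · intro hall
      refine le_antisymm radHom_le_hodgeClasses_hom fun f hf => ?_
      exact (Hom.toLinearMap_mem_radHom_iff (Hom.ofIsHom ((mem_hodgeClasses_hom_zero_iff G G' f).1 hf))).2 (hall _)
    · intro heq φ
      exact (Hom.toLinearMap_mem_radHom_iff φ).1 (heq ▸ Hom.toLinearMap_mem_hodgeClasses_hom_zero G G' φ)
  rw [key H H', radHom_eq_hodgeClasses_hom_comm H H']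
  -- the universes of `V` and `V'` are swapped on the right: redo the `key` argument directly
  constructor
  · intro heq ψ
    exact (Hom.toLinearMap_mem_radHom_iff ψ).1 (heq ▸ Hom.toLinearMap_mem_hodgeClasses_hom_zero H' H ψ)
  · intro hall
    refine le_antisymm radHom_le_hodgeClasses_hom fun f hf => ?_
    exact (Hom.toLinearMap_mem_radHom_iff (Hom.ofIsHom ((mem_hodgeClasses_hom_zero_iff H' H f).1 hf))).2 (hall _)

end Symmetry

end MixedHodgeStructure

end Literature.AlgebraicGeometry.Motives

end
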